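import Summits.FinalStateConjecture.FinalStateConjecture.Theses.ZeroEnergyKerrOrBomb
import Summits.FinalStateConjecture.FinalStateConjecture.Theses.AnalyticityInvadesErgoregion
import Summits.FinalStateConjecture.FinalStateConjecture.Theorems.ZeroEnergyKerrOrBombZeroEnergyRigidityRegularCase
import Summits.FinalStateConjecture.FinalStateConjecture.Theorems.ZeroEnergyKerrOrBombKerrOrBombDock
import Summits.FinalStateConjecture.FinalStateConjecture.Theorems.ZeroEnergyRigidity.Negative.CoreReduction

/-!
# Crux `KerrOrBomb` (stmt-FinalStateConjecture-10689) — hand-back `verdict: misstated`: restate bodies, elaborated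

Line lead c1 (prover-line-stmt-FinalStateConjecture-10689-c1-0), 2026-08-16.  Work/evidence file (NOT a
Theorems proposal: it declares candidate STATEMENTS, which only a planner files).

## Why the typed item is handed back

* `kerrOrBomb_of_core` : as TYPED, `KerrOrBomb` follows from `CoreRigidityGH` (= the sibling crux
  `ZeroEnergyRigidity` with h5, h6 deleted, `Negative.zeroEnergyRigidity_iff_core`, p95955) through the
  landed dock `KerrOrBombDock.kerrOrBomb_of_zeroEnergyRigidity` (p92061).  Mode stability (h6) is never
  spent; the "Kerr or bomb" dichotomy is not exercised (the typed `ErgoregionBomb` closed VACUOUSLY).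
* The sibling item stmt-10690 was handed back `verdict: misstated` by its gen-2 lead (10:28Z): three leads
  reduced every line to the same residue S1 (I⁺-regular re-presentation = horizon completion, open in
  print, CC08 p. 3 / CCH12 §3 p. 9).  Once 10690 is restated in an `I⁺`-regular telescope, the typed
  `KerrOrBomb` is orphaned (no restated sibling implies it; its own residue is the same S1), so it must be
  restated CONSISTENTLY.  This file gives the two consistent bodies and the kernel-checked glue.

## Restate C‴ (RECOMMENDED — keeps the route's thesis: mode stability is USED)

Telescope = the hypotheses of `AnalyticityInvadesErgoregion.NonTrappingHawkingRigidity` (stmt-13896)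
VERBATIM (vacuum, `IsIPlusRegular`, future-presented, `T ≠ 0` on the d.o.c., simply connected d.o.c.,
Killing–timelike collar `(U, K)` on a connected horizon, belt compact mod `T`) + `[Kerr.Facts]`:
* `KerrOrBombNTHR`       : telescope → MODE-STABLE (h6 of the typed item, verbatim) → KerrConclusion;
* `ErgoregionBombNTHR`   : telescope → a zero-energy null MAXIMAL geodesic trapped MOD THE FLOW
                           (negation of 13896's non-trapping clause) → growing Killing-mode pair
                           (conclusion of the typed `ErgoregionBomb`, verbatim);
* `ZeroEnergyRigidityNTHR`: telescope → non-trapping mod the flow (13896's clause verbatim) →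
                           KerrConclusion (= the sibling lead's recommended body, reconstructed from
                           `Cruxes/ZeroEnergyRigidity/NOTES.md`; the planner should diff it against the
                           sibling's `Restate.lean`);
* glue `kerrOrBombOfCruxesNTHR_proof : ZeroEnergyRigidityNTHR → ErgoregionBombNTHR → KerrOrBombNTHR`
  (8 lines of logic, sorry-free) — the rev-5 deciding theorem is ready;
* `zeroEnergyRigidityNTHR_of_dock : NTHRDock → NonTrappingHawkingRigidity → ZeroEnergyRigidityNTHR`
  (pure logic) — the restated rigidity crux = the SHARED Hawking step stmt-13896 + a dock
  (`NTHRDock`: collar field extended to the d.o.c. ⇒ Kerr; = Beig–Chruściel + CCH12 Thm 3.2 + the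
  landed `RegularCase`/`KerrChartTransfer`, the sibling's `DockGlue`).

## Restate A (alternative — known theorems; closes TODAY modulo the four named facts, h6 idle)

* `KerrOrBombRegular` : typed telescope with `IsIPlusRegular` added and the h3-witness taken complete and
  `T`-commuting → KerrConclusion; `kerrOrBombRegular_of_facts` proves it from `SudarskyWald1993_staticity`,
  `ChruscielGalloway2010_docStaticUniqueness`, `ChruscielCostaHeusler2012_axisymmetricUniqueness`,
  `BeigChrusciel1997_axisymmetricCombination` via the landed `RegularCase.stub_kerrConclusion_of_regular`
  (p89982); `kerrOrBombRegular_of_typed : KerrOrBomb → KerrOrBombRegular` records that A is a weakening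
  of the typed item (so nothing provable is lost).  Under A the route degenerates to "known uniqueness +
  StationaryLimitReduction" (the route's own kill criterion "smooth rigidity proved outright elsewhere").
-/

noncomputable section

-- `Summit.FinalStateConjecture.FinalStateConjecture.…`: summit = problem name (single-conjunct summit, D-0017).
set_option linter.dupNamespace false

namespace Summit.FinalStateConjecture.FinalStateConjecture.Theorems.KerrOrBomb.Restate

open Set Function Literature.Geometry.Lorentzian
open scoped Manifold Topology
open Summit.FinalStateConjecture.FinalStateConjecture.Theses.ZeroEnergyKerrOrBomb
  (KerrOrBomb ZeroEnergyRigidity ErgoregionBomb)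
open Summit.FinalStateConjecture.FinalStateConjecture.Theses.AnalyticityInvadesErgoregion
  (NonTrappingHawkingRigidity)

/-! ## 0. The typed item is implied by `CoreRigidityGH` (so it carries no usable mode-stability content) -/

/-- `CoreRigidityGH`: the typed telescope with h5 (`T ≠ 0` on the d.o.c.) and h6 (mode stability /
no imprisoned ray) deleted — Hawking-rigid smooth stationary vacuum black-hole uniqueness for globally
hyperbolic presentations.  Character-identical with the right-hand side of
`ZeroEnergyRigidity.Negative.zeroEnergyRigidity_iff_core`. -/
def CoreRigidityGH : Prop :=
  ∀ (𝓑 : StationaryAFBlackHole.{0}) [𝓑.metric.HasLeviCivita] [Kerr.Facts],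
    𝓑.metric.toPseudoRiemannianMetric.IsRicciFlat → IsConnected 𝓑.horizon →
    𝓑.toSpacetime.IsNonDegenerateHorizon 𝓑.Mext →
    𝓑.metric.IsGloballyHyperbolic 𝓑.timeOrientation →
    ∃ (M a : ℝ), Kerr.IsSubextremal M a ∧ ∃ Ψ : Kerr.exterior M a → 𝓑.carrier,
      Function.Injective Ψ ∧ Set.range Ψ = 𝓑.doc ∧
        PseudoRiemannianMetric.IsIsometricImmersion
          (Kerr.smoothMetric M a (Kerr.rPlus M a)).toPseudoRiemannianMetric
          𝓑.metric.toPseudoRiemannianMetric Ψ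

/-- **Typed `KerrOrBomb` ⇐ `CoreRigidityGH`**: the landed dock (p92061) after the landed
`zeroEnergyRigidity_iff_core` (p95955).  Hence every proof of the typed item that exists today is a
proof of `CoreRigidityGH`; h5 and h6 are idle. -/
theorem kerrOrBomb_of_core : CoreRigidityGH → KerrOrBomb := fun h ↦
  KerrOrBombDock.kerrOrBomb_of_zeroEnergyRigidity
    (ZeroEnergyRigidity.Negative.zeroEnergyRigidity_iff_core.mpr h)

/-! ## 1. Restate C‴ — the NTHR telescope (stmt-13896 verbatim) -/

/-- **`KerrOrBombNTHR` (recommended restate of the target).**  Hypotheses of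
`NonTrappingHawkingRigidity` (stmt-13896) verbatim, with its zero-energy non-trapping clause REPLACED by
Killing-mode stability (h6 of the typed `KerrOrBomb`, verbatim), plus `[Kerr.Facts]`; conclusion = the
typed Kerr-isometry conclusion verbatim. -/
def KerrOrBombNTHR : Prop :=
  ∀ (𝓑 : Literature.Geometry.Lorentzian.StationaryAFBlackHole.{0}) [𝓑.metric.HasLeviCivita] [Literature.Geometry.Lorentzian.Kerr.Facts], 𝓑.metric.toPseudoRiemannianMetric.IsRicciFlat → 𝓑.IsIPlusRegular → (∀ p : 𝓑.carrier, p ∈ 𝓑.metric.chronologicalFuture 𝓑.timeOrientation 𝓑.Mext) → (∀ p ∈ 𝓑.doc, 𝓑.killing p ≠ 0) → SimplyConnectedSpace 𝓑.doc → ∀ (U : Set 𝓑.carrier) (K : Π x : 𝓑.carrier, TangentSpace (𝓡 4) x), IsOpen U → 𝓑.horizon ⊆ U → IsConnected 𝓑.horizon → ContMDiffOn (𝓡 4) ((𝓡 4).prod 𝓘(ℝ, Literature.Geometry.Lorentzian.E4)) ((⊤ : ℕ∞) : WithTop ℕ∞) (fun x ↦ (Bundle.TotalSpace.mk' Literature.Geometry.Lorentzian.E4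 x (K x) : TangentBundle (𝓡 4) 𝓑.carrier)) U → (∀ x ∈ U, ∀ v w : TangentSpace (𝓡 4) x, 𝓑.metric.val x (𝓑.metric.leviCivita K x v) w + 𝓑.metric.val x v (𝓑.metric.leviCivita K x w) = 0) → (∀ x ∈ U, VectorField.mlieBracket (𝓡 4) 𝓑.killing K x = 0) → (∀ p ∈ 𝓑.horizon, K p ≠ 0) → (∀ γ : ℝ → 𝓑.carrier, IsMIntegralCurve γ K → γ 0 ∈ 𝓑.horizon → ∀ t, γ t ∈ 𝓑.horizon) → (∀ x ∈ U ∩ 𝓑.doc, 𝓑.metric.val x (K x) (K x) < 0) → (∃ S₀ : Set 𝓑.carrier, IsCompact S₀ ∧ S₀ ⊆ 𝓑.doc ∧ ∀ y ∈ 𝓑.doc, 0 ≤ 𝓑.metric.val y (𝓑.killing y) (𝓑.killing y) → y ∉ U → y ∈ Literature.Geometry.Lorentzian.stationaryOrbit 𝓑.killing S₀) → (∀ (ν ω : ℝ) (ψ χ : 𝓑.carrier → ℝ), 0 < ν → (∃ U : Set 𝓑.carrier, IsOpen U ∧ 𝓑.doc ∪ 𝓑.horizon ⊆ U ∧ ContMDiffOn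 (𝓡 4) 𝓘(ℝ, ℝ) ((⊤ : ℕ∞) : WithTop ℕ∞) ψ U ∧ ContMDiffOn (𝓡 4) 𝓘(ℝ, ℝ) ((⊤ : ℕ∞) : WithTop ℕ∞) χ U) → (∀ x ∈ 𝓑.doc, 𝓑.metric.dalembertian ψ x = 0 ∧ 𝓑.metric.dalembertian χ x = 0) → (∀ x ∈ 𝓑.doc, mfderiv (𝓡 4) 𝓘(ℝ, ℝ) ψ x (𝓑.killing x) = ν * ψ x - ω * χ x ∧ mfderiv (𝓡 4) 𝓘(ℝ, ℝ) χ x (𝓑.killing x) = ω * ψ x + ν * χ x) → (∃ C : ℝ, ∀ x ∈ 𝓑.doc ∩ 𝓑.metric.chronologicalPast 𝓑.timeOrientation (𝓑.embed '' 𝓑.e.far (𝓑.e.R + 1)), |ψ x| ≤ C ∧ |χ x| ≤ C) → ∀ x ∈ 𝓑.doc, ψ x = 0 ∧ χ x = 0) → ∃ (M a : ℝ), Literature.Geometry.Lorentzian.Kerr.IsSubextremal M a ∧ ∃ Ψ : Literature.Geometry.Lorentzian.Kerr.exterior M a → 𝓑.carrier, Function.Injective Ψ ∧ Set.range Ψ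 = 𝓑.doc ∧ Literature.Geometry.Lorentzian.PseudoRiemannianMetric.IsIsometricImmersion (Literature.Geometry.Lorentzian.Kerr.smoothMetric M a (Literature.Geometry.Lorentzian.Kerr.rPlus M a)).toPseudoRiemannianMetric 𝓑.metric.toPseudoRiemannianMetric Ψ

/-- **`ErgoregionBombNTHR` (restate of the bomb crux, intended mod-flow form).**  Same telescope; a
zero-energy null MAXIMAL geodesic whose whole domain stays in the `T`-orbit of a compact subset of the
d.o.c. (the negation of 13896's non-trapping clause) forces an exponentially growing Killing-mode pair
(conclusion of the typed `ErgoregionBomb`, verbatim).  Not vacuous: Kerr's trapped photon orbits are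
NOT zero-energy (support `KerrNoZeroEnergyTrapping`), and trapping is now modulo the flow, immune to the
non-imprisonment argument that voided the typed item. -/
def ErgoregionBombNTHR : Prop :=
  ∀ (𝓑 : Literature.Geometry.Lorentzian.StationaryAFBlackHole.{0}) [𝓑.metric.HasLeviCivita] [Literature.Geometry.Lorentzian.Kerr.Facts], 𝓑.metric.toPseudoRiemannianMetric.IsRicciFlat → 𝓑.IsIPlusRegular → (∀ p : 𝓑.carrier, p ∈ 𝓑.metric.chronologicalFuture 𝓑.timeOrientation 𝓑.Mext) → (∀ p ∈ 𝓑.doc, 𝓑.killing p ≠ 0) → SimplyConnectedSpace 𝓑.doc → ∀ (U : Set 𝓑.carrier) (K : Π x : 𝓑.carrier, TangentSpace (𝓡 4) x), IsOpen U → 𝓑.horizon ⊆ U → IsConnected 𝓑.horizon → ContMDiffOn (𝓡 4) ((𝓡 4).prod 𝓘(ℝ, Literature.Geometry.Lorentzian.E4)) ((⊤ : ℕ∞) : WithTop ℕ∞) (fun x ↦ (Bundle.TotalSpace.mk' Literature.Geometry.Lorentzian.E4 x (K x) : TangentBundle (𝓡 4) 𝓑.carrier)) U → (∀ x ∈ U,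 ∀ v w : TangentSpace (𝓡 4) x, 𝓑.metric.val x (𝓑.metric.leviCivita K x v) w + 𝓑.metric.val x v (𝓑.metric.leviCivita K x w) = 0) → (∀ x ∈ U, VectorField.mlieBracket (𝓡 4) 𝓑.killing K x = 0) → (∀ p ∈ 𝓑.horizon, K p ≠ 0) → (∀ γ : ℝ → 𝓑.carrier, IsMIntegralCurve γ K → γ 0 ∈ 𝓑.horizon → ∀ t, γ t ∈ 𝓑.horizon) → (∀ x ∈ U ∩ 𝓑.doc, 𝓑.metric.val x (K x) (K x) < 0) → (∃ S₀ : Set 𝓑.carrier, IsCompact S₀ ∧ S₀ ⊆ 𝓑.doc ∧ ∀ y ∈ 𝓑.doc, 0 ≤ 𝓑.metric.val y (𝓑.killing y) (𝓑.killing y) → y ∉ U → y ∈ Literature.Geometry.Lorentzian.stationaryOrbit 𝓑.killing S₀) → ∀ S : Set 𝓑.carrier, IsCompact S → S ⊆ 𝓑.doc → ∀ (γ : ℝ → 𝓑.carrier) (s : Set ℝ), Literature.Geometry.Lorentzian.IsMaximalGeodesicOn 𝓑.metric.toPseudoRiemannianMetric.leviCivita γ s → s.Nonempty → (∀ t ∈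 s, 𝓑.metric.val (γ t) (Literature.Geometry.Lorentzian.velocity (𝓡 4) γ t) (Literature.Geometry.Lorentzian.velocity (𝓡 4) γ t) = 0 ∧ Literature.Geometry.Lorentzian.velocity (𝓡 4) γ t ≠ 0 ∧ 𝓑.metric.val (γ t) (Literature.Geometry.Lorentzian.velocity (𝓡 4) γ t) (𝓑.killing (γ t)) = 0) → (∀ t ∈ s, γ t ∈ Literature.Geometry.Lorentzian.stationaryOrbit 𝓑.killing S) → ∃ (ν ω : ℝ) (ψ χ : 𝓑.carrier → ℝ), 0 < ν ∧ (∃ U : Set 𝓑.carrier, IsOpen U ∧ 𝓑.doc ∪ 𝓑.horizon ⊆ U ∧ ContMDiffOn (𝓡 4) 𝓘(ℝ, ℝ) ((⊤ : ℕ∞) : WithTop ℕ∞) ψ U ∧ ContMDiffOn (𝓡 4) 𝓘(ℝ, ℝ) ((⊤ : ℕ∞) : WithTop ℕ∞) χ U) ∧ (∀ x ∈ 𝓑.doc, 𝓑.metric.dalembertian ψ x = 0 ∧ 𝓑.metric.dalembertian χ x = 0) ∧ (∀ x ∈ 𝓑.doc, mfderiv (𝓡 4) 𝓘(ℝ, ℝ)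 ψ x (𝓑.killing x) = ν * ψ x - ω * χ x ∧ mfderiv (𝓡 4) 𝓘(ℝ, ℝ) χ x (𝓑.killing x) = ω * ψ x + ν * χ x) ∧ (∃ C : ℝ, ∀ x ∈ 𝓑.doc ∩ 𝓑.metric.chronologicalPast 𝓑.timeOrientation (𝓑.embed '' 𝓑.e.far (𝓑.e.R + 1)), |ψ x| ≤ C ∧ |χ x| ≤ C) ∧ ∃ x ∈ 𝓑.doc, ψ x ≠ 0 ∨ χ x ≠ 0

/-- **`ZeroEnergyRigidityNTHR` (restate of the rigidity crux; the sibling lead's recommended body,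
reconstructed).**  Telescope of stmt-13896 verbatim INCLUDING its non-trapping clause, plus
`[Kerr.Facts]`, concluding the Kerr isometry. -/
def ZeroEnergyRigidityNTHR : Prop :=
  ∀ (𝓑 : Literature.Geometry.Lorentzian.StationaryAFBlackHole.{0}) [𝓑.metric.HasLeviCivita] [Literature.Geometry.Lorentzian.Kerr.Facts], 𝓑.metric.toPseudoRiemannianMetric.IsRicciFlat → 𝓑.IsIPlusRegular → (∀ p : 𝓑.carrier, p ∈ 𝓑.metric.chronologicalFuture 𝓑.timeOrientation 𝓑.Mext) → (∀ p ∈ 𝓑.doc, 𝓑.killing p ≠ 0) → SimplyConnectedSpace 𝓑.doc → ∀ (U : Set 𝓑.carrier) (K : Π x : 𝓑.carrier, TangentSpace (𝓡 4) x), IsOpen U → 𝓑.horizon ⊆ U → IsConnected 𝓑.horizon → ContMDiffOn (𝓡 4) ((𝓡 4).prod 𝓘(ℝ, Literature.Geometry.Lorentzian.E4)) ((⊤ : ℕ∞) : WithTop ℕ∞) (fun x ↦ (Bundle.TotalSpace.mk' Literature.Geometry.Lorentzian.E4 x (K x) : TangentBundle (𝓡 4) 𝓑.carrier)) U → (∀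 x ∈ U, ∀ v w : TangentSpace (𝓡 4) x, 𝓑.metric.val x (𝓑.metric.leviCivita K x v) w + 𝓑.metric.val x v (𝓑.metric.leviCivita K x w) = 0) → (∀ x ∈ U, VectorField.mlieBracket (𝓡 4) 𝓑.killing K x = 0) → (∀ p ∈ 𝓑.horizon, K p ≠ 0) → (∀ γ : ℝ → 𝓑.carrier, IsMIntegralCurve γ K → γ 0 ∈ 𝓑.horizon → ∀ t, γ t ∈ 𝓑.horizon) → (∀ x ∈ U ∩ 𝓑.doc, 𝓑.metric.val x (K x) (K x) < 0) → (∃ S₀ : Set 𝓑.carrier, IsCompact S₀ ∧ S₀ ⊆ 𝓑.doc ∧ ∀ y ∈ 𝓑.doc, 0 ≤ 𝓑.metric.val y (𝓑.killing y) (𝓑.killing y) → y ∉ U → y ∈ Literature.Geometry.Lorentzian.stationaryOrbit 𝓑.killing S₀) → (∀ S : Set 𝓑.carrier, IsCompact S → S ⊆ 𝓑.doc → ∀ (γ : ℝ → 𝓑.carrier) (s : Set ℝ), Literature.Geometry.Lorentzian.IsMaximalGeodesicOn 𝓑.metric.toPseudoRiemannianMetric.leviCivita γ s → s.Nonempty →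 (∀ t ∈ s, 𝓑.metric.val (γ t) (Literature.Geometry.Lorentzian.velocity (𝓡 4) γ t) (Literature.Geometry.Lorentzian.velocity (𝓡 4) γ t) = 0 ∧ Literature.Geometry.Lorentzian.velocity (𝓡 4) γ t ≠ 0 ∧ 𝓑.metric.val (γ t) (Literature.Geometry.Lorentzian.velocity (𝓡 4) γ t) (𝓑.killing (γ t)) = 0) → ∃ t ∈ s, γ t ∉ Literature.Geometry.Lorentzian.stationaryOrbit 𝓑.killing S) → ∃ (M a : ℝ), Literature.Geometry.Lorentzian.Kerr.IsSubextremal M a ∧ ∃ Ψ : Literature.Geometry.Lorentzian.Kerr.exterior M a → 𝓑.carrier, Function.Injective Ψ ∧ Set.range Ψ = 𝓑.doc ∧ Literature.Geometry.Lorentzian.PseudoRiemannianMetric.IsIsometricImmersion (Literature.Geometry.Lorentzian.Kerr.smoothMetric M a (Literature.Geometry.Lorentzian.Kerr.rPlus M a)).toPseudoRiemannianMetric 𝓑.metric.toPseudoRiemannianMetric Ψ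

/-- **Glue of the restated route**: `ZeroEnergyRigidityNTHR → ErgoregionBombNTHR → KerrOrBombNTHR`. -/
def KerrOrBombOfCruxesNTHR : Prop :=
  ZeroEnergyRigidityNTHR → ErgoregionBombNTHR → KerrOrBombNTHR

/-- **The restated glue is eight lines of logic** (as the typed one was): a mode-stable hole in the
NTHR telescope has no zero-energy ray trapped mod the flow — otherwise `ErgoregionBombNTHR` hands a
growing mode pair that mode stability kills on the d.o.c., contradicting its non-vanishing — so
`ZeroEnergyRigidityNTHR` applies. -/
theorem kerrOrBombOfCruxesNTHR_proof : KerrOrBombOfCruxesNTHR := by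
  intro hZ hE 𝓑 _ _ hRic hreg hfut hT hsc U K hUo hHU hconn hKs hKill hcomm hne htan hcollar hbelt hms
  refine hZ 𝓑 hRic hreg hfut hT hsc U K hUo hHU hconn hKs hKill hcomm hne htan hcollar hbelt ?_
  intro S hS hSd γ s hγ hs hnull
  by_contra hcon
  push Not at hcon
  obtain ⟨ν, ω, ψ, χ, hν, hU, hwave, hmode, hbdd, x, hx, hnz⟩ :=
    hE 𝓑 hRic hreg hfut hT hsc U K hUo hHU hconn hKs hKill hcomm hne htan hcollar hbelt
      S hS hSd γ s hγ hs hnull hcon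
  have hzero := hms ν ω ψ χ hν hU hwave hmode hbdd x hx
  rcases hnz with h | h
  · exact h hzero.1
  · exact h hzero.2

/-- **`NTHRDock`**: in the NTHR telescope, the conclusion of stmt-13896 (the collar field extends to a
`T`-commuting Killing field on the whole d.o.c.) implies the Kerr isometry.  (Beig–Chruściel
combination + CCH12 Thm. 3.2 + the landed `RegularCase`/`KerrChartTransfer`; the collar sign
`g(K,K) < 0` excludes the extreme-Kerr alternative.  This is the sibling lead's `DockGlue`, here only
STATED so that the chain below type-checks.) -/
def NTHRDock : Prop :=
  ∀ (𝓑 : Literature.Geometry.Lorentzian.StationaryAFBlackHole.{0}) [𝓑.metric.HasLeviCivita] [Literature.Geometry.Lorentzian.Kerr.Facts], 𝓑.metric.toPseudoRiemannianMetric.IsRicciFlat → 𝓑.IsIPlusRegular → (∀ p : 𝓑.carrier, p ∈ 𝓑.metric.chronologicalFuture 𝓑.timeOrientation 𝓑.Mext) → (∀ p ∈ 𝓑.doc, 𝓑.killing p ≠ 0) → SimplyConnectedSpace 𝓑.doc → ∀ (U : Set 𝓑.carrier) (K : Π x : 𝓑.carrier, TangentSpace (𝓡 4) x), IsOpen U →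 𝓑.horizon ⊆ U → IsConnected 𝓑.horizon → ContMDiffOn (𝓡 4) ((𝓡 4).prod 𝓘(ℝ, Literature.Geometry.Lorentzian.E4)) ((⊤ : ℕ∞) : WithTop ℕ∞) (fun x ↦ (Bundle.TotalSpace.mk' Literature.Geometry.Lorentzian.E4 x (K x) : TangentBundle (𝓡 4) 𝓑.carrier)) U → (∀ x ∈ U, ∀ v w : TangentSpace (𝓡 4) x, 𝓑.metric.val x (𝓑.metric.leviCivita K x v) w + 𝓑.metric.val x v (𝓑.metric.leviCivita K x w) = 0) → (∀ x ∈ U, VectorField.mlieBracket (𝓡 4) 𝓑.killing K x = 0) → (∀ p ∈ 𝓑.horizon, K p ≠ 0) → (∀ γ : ℝ → 𝓑.carrier, IsMIntegralCurve γ K → γ 0 ∈ 𝓑.horizon → ∀ t, γ t ∈ 𝓑.horizon) → (∀ x ∈ U ∩ 𝓑.doc, 𝓑.metric.val x (K x) (K x) < 0) → (∃ S₀ : Set 𝓑.carrier, IsCompact S₀ ∧ S₀ ⊆ 𝓑.doc ∧ ∀ y ∈ 𝓑.doc, 0 ≤ 𝓑.metric.val y (𝓑.killing y) (𝓑.killing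 y) → y ∉ U → y ∈ Literature.Geometry.Lorentzian.stationaryOrbit 𝓑.killing S₀) → (∀ S : Set 𝓑.carrier, IsCompact S → S ⊆ 𝓑.doc → ∀ (γ : ℝ → 𝓑.carrier) (s : Set ℝ), Literature.Geometry.Lorentzian.IsMaximalGeodesicOn 𝓑.metric.toPseudoRiemannianMetric.leviCivita γ s → s.Nonempty → (∀ t ∈ s, 𝓑.metric.val (γ t) (Literature.Geometry.Lorentzian.velocity (𝓡 4) γ t) (Literature.Geometry.Lorentzian.velocity (𝓡 4) γ t) = 0 ∧ Literature.Geometry.Lorentzian.velocity (𝓡 4) γ t ≠ 0 ∧ 𝓑.metric.val (γ t) (Literature.Geometry.Lorentzian.velocity (𝓡 4) γ t) (𝓑.killing (γ t)) = 0) → ∃ t ∈ s, γ t ∉ Literature.Geometry.Lorentzian.stationaryOrbit 𝓑.killing S) → (∃ K' : Π x : 𝓑.carrier, TangentSpace (𝓡 4) x, ContMDiffOn (𝓡 4) ((𝓡 4).prod 𝓘(ℝ, Literature.Geometry.Lorentzian.E4)) ((⊤ : ℕ∞) : WithTop ℕ∞) (fun x ↦ (Bundle.TotalSpace.mk' Literature.Geometry.Lorentzian.E4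 x (K' x) : TangentBundle (𝓡 4) 𝓑.carrier)) 𝓑.doc ∧ (∀ x ∈ 𝓑.doc, ∀ v w : TangentSpace (𝓡 4) x, 𝓑.metric.val x (𝓑.metric.leviCivita K' x v) w + 𝓑.metric.val x v (𝓑.metric.leviCivita K' x w) = 0) ∧ (∀ x ∈ 𝓑.doc, VectorField.mlieBracket (𝓡 4) 𝓑.killing K' x = 0) ∧ ∃ U' : Set 𝓑.carrier, IsOpen U' ∧ 𝓑.horizon ⊆ U' ∧ ∀ x ∈ U' ∩ 𝓑.doc, K' x = K x) → ∃ (M a : ℝ), Literature.Geometry.Lorentzian.Kerr.IsSubextremal M a ∧ ∃ Ψ : Literature.Geometry.Lorentzian.Kerr.exterior M a → 𝓑.carrier, Function.Injective Ψ ∧ Set.range Ψ = 𝓑.doc ∧ Literature.Geometry.Lorentzian.PseudoRiemannianMetric.IsIsometricImmersion (Literature.Geometry.Lorentzian.Kerr.smoothMetric M a (Literature.Geometry.Lorentzian.Kerr.rPlus M a)).toPseudoRiemannianMetric 𝓑.metric.toPseudoRiemannianMetric Ψ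

/-- **Restated rigidity crux = shared Hawking step + dock** (pure logic):
`NTHRDock → NonTrappingHawkingRigidity → ZeroEnergyRigidityNTHR`. -/
theorem zeroEnergyRigidityNTHR_of_dock :
    NTHRDock → NonTrappingHawkingRigidity → ZeroEnergyRigidityNTHR := by
  intro hD hN 𝓑 _ _ hRic hreg hfut hT hsc U K hUo hHU hconn hKs hKill hcomm hne htan hcollar hbelt hnt
  exact hD 𝓑 hRic hreg hfut hT hsc U K hUo hHU hconn hKs hKill hcomm hne htan hcollar hbelt hnt
    (hN 𝓑 hRic hreg hfut hT hsc U K hUo hHU hconn hKs hKill hcomm hne htan hcollar hbelt hnt)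

/-! ## 2. Restate A — the regular telescope (known theorems) -/

/-- **`KerrOrBombRegular` (alternative restate).**  The typed telescope with `𝓑.IsIPlusRegular` added
and the h3-witness `K` taken COMPLETE and `T`-COMMUTING (the two clauses h3 lacks, Disproof F7(ii)/(iii)
of the sibling), h4–h6 kept verbatim; conclusion verbatim. -/
def KerrOrBombRegular : Prop :=
  ∀ (𝓑 : Literature.Geometry.Lorentzian.StationaryAFBlackHole.{0}) [𝓑.metric.HasLeviCivita]
    [Literature.Geometry.Lorentzian.Kerr.Facts],
    𝓑.metric.toPseudoRiemannianMetric.IsRicciFlat → 𝓑.IsIPlusRegular → IsConnected 𝓑.horizon →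
    (∃ K : Π x : 𝓑.carrier, TangentSpace (𝓡 4) x,
      𝓑.metric.IsKillingField K ∧ Literature.Geometry.Lorentzian.IsCompleteVectorField K ∧
      (∀ x, VectorField.mlieBracket (𝓡 4) 𝓑.killing K x = 0) ∧
      (∀ p ∈ 𝓑.horizon, K p ≠ 0) ∧
      (∀ γ : ℝ → 𝓑.carrier, IsMIntegralCurve γ K → γ 0 ∈ 𝓑.horizon → ∀ t, γ t ∈ 𝓑.horizon) ∧
      ∃ κ : ℝ, κ ≠ 0 ∧ ∀ p ∈ 𝓑.horizon, 𝓑.metric.leviCivita K p (K p) = κ • K p) →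
    𝓑.metric.IsGloballyHyperbolic 𝓑.timeOrientation → (∀ p ∈ 𝓑.doc, 𝓑.killing p ≠ 0) →
    (∀ (ν ω : ℝ) (ψ χ : 𝓑.carrier → ℝ), 0 < ν → (∃ U : Set 𝓑.carrier, IsOpen U ∧ 𝓑.doc ∪ 𝓑.horizon ⊆ U ∧ ContMDiffOn (𝓡 4) 𝓘(ℝ, ℝ) ((⊤ : ℕ∞) : WithTop ℕ∞) ψ U ∧ ContMDiffOn (𝓡 4) 𝓘(ℝ, ℝ) ((⊤ : ℕ∞) : WithTop ℕ∞) χ U) → (∀ x ∈ 𝓑.doc, 𝓑.metric.dalembertian ψ x = 0 ∧ 𝓑.metric.dalembertian χ x = 0) → (∀ x ∈ 𝓑.doc, mfderiv (𝓡 4) 𝓘(ℝ, ℝ) ψ x (𝓑.killing x) = ν * ψ x - ω * χ x ∧ mfderiv (𝓡 4) 𝓘(ℝ, ℝ) χ x (𝓑.killing x) = ω * ψ x + ν * χ x) → (∃ C : ℝ, ∀ x ∈ 𝓑.doc ∩ 𝓑.metric.chronologicalPast 𝓑.timeOrientation (𝓑.embed '' 𝓑.e.far (𝓑.e.R + 1)),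 |ψ x| ≤ C ∧ |χ x| ≤ C) → ∀ x ∈ 𝓑.doc, ψ x = 0 ∧ χ x = 0) → ∃ (M a : ℝ), Literature.Geometry.Lorentzian.Kerr.IsSubextremal M a ∧ ∃ Ψ : Literature.Geometry.Lorentzian.Kerr.exterior M a → 𝓑.carrier, Function.Injective Ψ ∧ Set.range Ψ = 𝓑.doc ∧ Literature.Geometry.Lorentzian.PseudoRiemannianMetric.IsIsometricImmersion (Literature.Geometry.Lorentzian.Kerr.smoothMetric M a (Literature.Geometry.Lorentzian.Kerr.rPlus M a)).toPseudoRiemannianMetric 𝓑.metric.toPseudoRiemannianMetric Ψ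

/-- **Restate A closes today modulo the four published theorems** (Literature named facts), by the
landed regular-case dichotomy `RegularCase.stub_kerrConclusion_of_regular` (p89982: CCH12 §3 —
non-rotating branch Sudarsky–Wald + static uniqueness, rotating branch Beig–Chruściel + CCH12 Thm 3.2).
Global hyperbolicity, `T ≠ 0` and mode stability are not used. -/
theorem kerrOrBombRegular_of_facts :
    SudarskyWald1993_staticity → ChruscielGalloway2010_docStaticUniqueness →
    ChruscielCostaHeusler2012_axisymmetricUniqueness.{0} →
    BeigChrusciel1997_axisymmetricCombination.{0} → KerrOrBombRegular := by
  intro h₁ h₂ h₃ h₄ 𝓑 _ _ hRic hreg hconn hK _ _ _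
  exact ZeroEnergyRigidity.GlobalHorizonKillingField.RegularCase.stub_kerrConclusion_of_regular
    h₁ h₂ h₃ h₄ 𝓑 hRic hreg hconn hK

/-- **Restate A is a weakening of the typed item** (pure logic: forget `I⁺`-regularity, completeness
and commutation of the witness), so the restate loses nothing that is provable about the typed decl. -/
theorem kerrOrBombRegular_of_typed : KerrOrBomb → KerrOrBombRegular := by
  intro h 𝓑 _ _ hRic _hreg hconn hK h4 h5 h6
  obtain ⟨K, hKf, -, -, hne, htan, hκ⟩ := hK
  exact h 𝓑 hRic hconn ⟨K, hKf, hne, htan, hκ⟩ h4 h5 h6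

end Summit.FinalStateConjecture.FinalStateConjecture.Theorems.KerrOrBomb.Restate

end
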